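import Literature.RepresentationTheory.ClassicalInvariants.SymplecticInvolutionTensorFFT
import Literature.RepresentationTheory.ClassicalInvariants.TensorFFTLetterColoured
import HarnessLib

/-!
# Route `Q8SymplecticPowers`, programme K2Q ∕ F-Q — brick F1C (part a): **the tensor FFT for the DIAGONAL symplectic group
# `{γ ⊕ γ : γ ∈ Sp(Ω)}` on the doubled alphabet `Fin k ⊕ Fin k`** — invariants are spanned by the block-placed complete
# contractions

Support file for crux K2Q `PowersHodgeOfQuaternionCommutators` (stmt-HodgeConjecture-24191; `--supports … --as helper`;
nothing here closes an item). Prover seat `hodge-nonav-20241-p1` (g21). Pure invariant theory over a field `K` of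
characteristic `0`, in the coefficient-tensor language of the tree's `ClassicalInvariants/SymplecticTensorFFT*`.

In the adapted basis `(m_p, b m_p)` of a quadratic space with a quaternionic structure (brick F1A
`Q8SymplecticPowersQuaternionicAdaptedBasis`), the quaternionic-unitary centraliser acts on `V = M ⊕ bM ≅ M ⊗ K²` as the
DIAGONAL symplectic group: `γ ∈ Sp(Ω)` acts by `fromBlocks γ 0 0 γ` (the same `γ` on both copies — NOT the product group
`Sp × Sp` of the tree's block-diagonal FFT `SymplecticTensorFFTBlockDiagonal`). Its invariants in `V^{⊗m}` are
`(M^{⊗m})^{Sp} ⊗ (K²)^{⊗m}`: Goodman–Wallach Thm. 5.3.3 (2) ∕ 5.3.5 on each COLOUR-PATTERN SLICE. This file proves exactly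
that, for an arbitrary alternating non-degenerate `Ω` on `K^k`:

* §1 words `w : Fin m → Fin k ⊕ Fin k` ↔ (colour pattern `κ = isLeft ∘ w : Fin m → Bool`, letters `u : Fin m → Fin k`);
  the Kronecker power of `fromBlocks γ 0 0 γ` preserves the pattern and acts on the letters by `γ^{⊗m}`
  (`prod_fromBlocks_glue`); hence every slice `u ↦ c(glue κ u)` of an invariant `c` is `Sp(Ω)`-invariant (`slice_invariant`);
* §2 the one-colour FFT (`mem_span_completeContractionOn_inv_of_sp_invariant`, Goodman–Wallach Thm. 5.3.3 (2)) on each slice,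
  and reassembly `c = Σ_κ ext_κ(slice_κ)` (`eq_sum_ext_slice`), where the extension by zero of a complete contraction of
  `Ω⁻¹` off the pattern `κ` is the TAGGED contraction whose pair `j` carries the block-placed matrix
  `bp(Ω⁻¹)(κ p_j, κ q_j)` — `Ω⁻¹` put in the block `(κ p_j, κ q_j)` of a `(Fin k ⊕ Fin k)`-matrix, zero elsewhere
  (`ext_completeContractionOn`);
* **`mem_span_taggedContraction_blockPlace_of_diagonal_invariant`** — a coefficient tensor on `(Fin k ⊕ Fin k)`-words fixed by
  `(fromBlocks γ 0 0 γ)^{⊗m}` for every `γ ∈ Sp(Ω)` is a `K`-combination of the tagged contractions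
  `taggedContraction (bp Ω⁻¹) e τ`, `e` a perfect matching of `Fin m`, `τ : pairs → Bool × Bool`.

Part b (`Q8SymplecticPowersQuaternionicTensorFFT`) rewrites the four block placements of `Ω⁻¹` as combinations of the
quaternionic Casimir matrices `[d]_β [Q]_β⁻¹`, `d ∈ {1, a, b, ab}`, and transports to an arbitrary basis.
HONEST FRAMING: invariant theory only (axioms standard); item 24191 OPEN; nothing here says HC ∕ HC_CM ∕ HC_AV is proved.

## References

* R. Goodman, N. Wallach, *Symmetry, Representations, and Invariants*, GTM 255 (2009), §5.3.2 Thm. 5.3.3 (2), Thm. 5.3.5;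
  §4.1.1 and §4.2.2 Prop. 4.2.5 (invariants of a group acting on one tensor factor). [cite: GoodmanWallachGTM255]
-/

set_option linter.dupNamespace false

noncomputable section

open scoped BigOperators Matrix

namespace Summit.HodgeConjecture.HodgeConjecture.Theorems.Q8SymplecticPowersDoubledAlphabetFFT

open Literature.RepresentationTheory.ClassicalInvariants

universe u

variable {K : Type u} [Field K] {k m : ℕ}

/-! ### §1 Words in the doubled alphabet: colour pattern and letters -/

/-- The colour pattern of a word in the doubled alphabet. Local notation only. -/
local notation3 (prettyPrint := false) "pat[" w "]" => (fun t => Sum.isLeft (w t))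

/-- The letters of a word in the doubled alphabet. Local notation only. -/
local notation3 (prettyPrint := false) "ltr[" w "]" => (fun t => Sum.elim id id (w t))

/-- The word with colour pattern `κ` and letters `u`. Local notation only. -/
local notation3 (prettyPrint := false) "glue[" κ ", " u "]" =>
  (fun t => bif κ t then (Sum.inl (u t) : Fin k ⊕ Fin k) else Sum.inr (u t))

/-- Extension by zero off the pattern `κ` of a function of the letters. Local notation only. -/
local notation3 (prettyPrint := false) "ext[" κ ", " f "]" =>
  (fun w : Fin m → Fin k ⊕ Fin k => if (fun t => Sum.isLeft (w t)) = κ then f (fun t => Sum.elim id id (w t)) else (0 : K))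

/-- The BLOCK PLACEMENTS of a `k × k` matrix `Θ` in a `(Fin k ⊕ Fin k)`-matrix: `bp Θ (c₁, c₂)` has `Θ` in the block
`(c₁, c₂)` (`true` = the `inl` copy) and zeros elsewhere. Local notation only. -/
local notation3 (prettyPrint := false) "bp[" Θ "]" =>
  (fun cc : Bool × Bool => Matrix.of fun x y : Fin k ⊕ Fin k =>
    if Sum.isLeft x = cc.1 ∧ Sum.isLeft y = cc.2 then Θ (Sum.elim id id x) (Sum.elim id id y) else (0 : K))

omit [Field K] in
/-- `glue (pat w) (ltr w) = w`. [folklore] -/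
theorem glue_pat_ltr (w : Fin m → Fin k ⊕ Fin k) : glue[pat[w], ltr[w]] = w := by
  funext t
  rcases h : w t with q | q <;> simp [h]

omit [Field K] in
/-- `pat (glue κ u) = κ`. [folklore] -/
theorem pat_glue (κ : Fin m → Bool) (u : Fin m → Fin k) : pat[glue[κ, u]] = κ := by
  funext t
  cases h : κ t <;> simp [h]

omit [Field K] in
/-- `ltr (glue κ u) = u`. [folklore] -/
theorem ltr_glue (κ : Fin m → Bool) (u : Fin m → Fin k) : ltr[glue[κ, u]] = u := by
  funext t
  cases h : κ t <;> simp [h]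

omit [Field K] in
/-- `glue κ` is injective. [folklore] -/
theorem glue_injective (κ : Fin m → Bool) : Function.Injective fun u : Fin m → Fin k => glue[κ, u] := by
  intro u u' h
  have h' := congr_arg (fun w : Fin m → Fin k ⊕ Fin k => ltr[w]) h
  simp only [ltr_glue] at h'
  exact h'

omit [Field K] in
/-- The colour of a glued letter. [folklore] -/
theorem isLeft_glue (κ : Fin m → Bool) (u : Fin m → Fin k) (t : Fin m) :
    Sum.isLeft (bif κ t then (Sum.inl (u t) : Fin k ⊕ Fin k) else Sum.inr (u t)) = κ t := by
  cases κ t <;> rfl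

omit [Field K] in
/-- The letter of a glued letter. [folklore] -/
theorem elim_glue (κ : Fin m → Bool) (u : Fin m → Fin k) (t : Fin m) :
    Sum.elim id id (bif κ t then (Sum.inl (u t) : Fin k ⊕ Fin k) else Sum.inr (u t)) = u t := by
  cases κ t <;> rfl

/-- The entries of `γ ⊕ γ` at a glued row index: zero across colours, `γ` within a colour.
[cite: GoodmanWallachGTM255, §4.2.2] -/
theorem fromBlocks_glue_apply (γ : Matrix (Fin k) (Fin k) K) (κ : Fin m → Bool) (u : Fin m → Fin k) (t : Fin m)
    (x : Fin k ⊕ Fin k) :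
    Matrix.fromBlocks γ 0 0 γ (bif κ t then (Sum.inl (u t) : Fin k ⊕ Fin k) else Sum.inr (u t)) x =
      if Sum.isLeft x = κ t then γ (u t) (Sum.elim id id x) else 0 := by
  cases hk : κ t <;> rcases x with q | q <;> simp

/-- **The Kronecker power of `γ ⊕ γ` preserves the colour pattern and acts on the letters by `γ^{⊗m}`.**
[cite: GoodmanWallachGTM255, §4.2.2] -/
theorem prod_fromBlocks_glue (γ : Matrix (Fin k) (Fin k) K) (κ : Fin m → Bool) (u : Fin m → Fin k)
    (w : Fin m → Fin k ⊕ Fin k) :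
    (∏ t, Matrix.fromBlocks γ 0 0 γ (glue[κ, u] t) (w t)) =
      if pat[w] = κ then ∏ t, γ (u t) (ltr[w] t) else 0 := by
  simp only [fromBlocks_glue_apply]
  by_cases h : pat[w] = κ
  · rw [if_pos h]
    exact Finset.prod_congr rfl fun t _ => by rw [if_pos (congr_fun h t)]
  · rw [if_neg h]
    obtain ⟨t, ht⟩ := Function.ne_iff.1 h
    exact Finset.prod_eq_zero (Finset.mem_univ t) (if_neg ht)

/-- **Every colour-pattern slice of a `(γ ⊕ γ)`-invariant coefficient tensor is `γ`-invariant** (vector convention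
`Σ_w (∏_t g (w' t) (w t)) c(w) = c(w')`). [cite: GoodmanWallachGTM255, §4.2.2 Prop. 4.2.5 and §4.1.1] -/
theorem slice_invariant (c : (Fin m → Fin k ⊕ Fin k) → K) (γ : Matrix (Fin k) (Fin k) K)
    (hc : ∀ w' : Fin m → Fin k ⊕ Fin k, (∑ w, (∏ t, Matrix.fromBlocks γ 0 0 γ (w' t) (w t)) * c w) = c w')
    (κ : Fin m → Bool) (u : Fin m → Fin k) :
    (∑ u₂ : Fin m → Fin k, (∏ t, γ (u t) (u₂ t)) * c glue[κ, u₂]) = c glue[κ, u] := by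
  have h := hc glue[κ, u]
  rw [sum_eq_sum_comp_of_injective (fun u₂ : Fin m → Fin k => glue[κ, u₂]) (glue_injective κ)] at h
  · rw [← h]
    refine Finset.sum_congr rfl fun u₂ _ => ?_
    simp only [fromBlocks_glue_apply, isLeft_glue, elim_glue, if_true]
  · intro w hw
    have hpat : pat[w] ≠ κ := by
      intro hp
      exact hw ⟨ltr[w], by simp only; rw [← hp]; exact glue_pat_ltr w⟩
    rw [prod_fromBlocks_glue, if_neg hpat, zero_mul]

/-! ### §2 Slices of invariants are complete contractions; reassembly -/

/-- **A coefficient tensor is the sum of the extensions by zero of its slices.** [cite: GoodmanWallachGTM255, §4.1.1] -/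
theorem eq_sum_ext_slice (c : (Fin m → Fin k ⊕ Fin k) → K) :
    c = ∑ κ : Fin m → Bool, ext[κ, fun u => c glue[κ, u]] := by
  funext w
  rw [Finset.sum_apply, Finset.sum_eq_single pat[w]]
  · simp only [if_true, glue_pat_ltr]
  · intro κ _ hκ
    rw [if_neg (Ne.symm hκ)]
  · intro h; exact absurd (Finset.mem_univ _) h

/-- **The extension by zero of a complete contraction off the pattern `κ` is the tagged contraction with the block-placed
matrices** (the pair `j` is tagged by the colours `(κ p_j, κ q_j)` of its two positions). [cite: GoodmanWallachGTM255, §5.3.2] -/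
theorem ext_completeContractionOn (Θ : Matrix (Fin k) (Fin k) K) (κ : Fin m → Bool) {j : ℕ} (e : Fin m ≃ Fin 2 × Fin j) :
    ext[κ, completeContractionOn Θ e] =
      taggedContraction bp[Θ] e (fun l => (κ (e.symm (0, l)), κ (e.symm (1, l)))) := by
  funext w
  rw [taggedContraction_apply]
  by_cases h : pat[w] = κ
  · rw [if_pos h, completeContractionOn_apply]
    refine Finset.prod_congr rfl fun l _ => ?_
    rw [Matrix.of_apply, if_pos ⟨congr_fun h _, congr_fun h _⟩]
  · rw [if_neg h]
    obtain ⟨t, ht⟩ := Function.ne_iff.1 h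
    symm
    -- the pair through `t` vanishes
    obtain ⟨⟨r, l⟩, hrl⟩ : ∃ q : Fin 2 × Fin j, e.symm q = t := ⟨e t, e.symm_apply_apply t⟩
    refine Finset.prod_eq_zero (Finset.mem_univ l) ?_
    rw [Matrix.of_apply, if_neg]
    rintro ⟨h0, h1⟩
    fin_cases r
    · exact ht (by rw [← hrl]; exact h0)
    · exact ht (by rw [← hrl]; exact h1)

/-- `ext κ` is additive. [folklore] -/
theorem ext_add (κ : Fin m → Bool) (f g : (Fin m → Fin k) → K) : ext[κ, f + g] = ext[κ, f] + ext[κ, g] := by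
  funext w
  simp only [Pi.add_apply]
  split_ifs <;> simp

/-- `ext κ` is homogeneous. [folklore] -/
theorem ext_smul (κ : Fin m → Bool) (r : K) (f : (Fin m → Fin k) → K) : ext[κ, r • f] = r • ext[κ, f] := by
  funext w
  simp only [Pi.smul_apply, smul_eq_mul]
  split_ifs <;> simp

/-- `ext κ 0 = 0`. [folklore] -/
theorem ext_zero (κ : Fin m → Bool) : ext[κ, (0 : (Fin m → Fin k) → K)] = 0 := by
  funext w
  simp only [Pi.zero_apply]
  split_ifs <;> simp

/-- **The tensor FFT for the diagonal symplectic group on the doubled alphabet.** Let `Ω` be an alternating non-degenerate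
`k × k` matrix over a field of characteristic `0`, and `c : (Fin m → Fin k ⊕ Fin k) → K` a coefficient tensor fixed by
the Kronecker power of `fromBlocks γ 0 0 γ` for every `γ` with `γᵀ Ω γ = Ω`. Then `c` is a `K`-combination of the tagged
contractions `taggedContraction (bp Ω⁻¹) e τ` — perfect matchings `e` of the `m` positions, each pair contracted with
`Ω⁻¹` placed in one of the four blocks. (Goodman–Wallach Thm. 5.3.3 (2) ∕ 5.3.5 on each colour-pattern slice, via the
tree's `mem_span_completeContractionOn_inv_of_sp_invariant`, and reassembly.)
[cite: GoodmanWallachGTM255, §5.3.2 Thm. 5.3.3 (2), Thm. 5.3.5; §4.2.2 Prop. 4.2.5] -/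
theorem mem_span_taggedContraction_blockPlace_of_diagonal_invariant [CharZero K] {Ω : Matrix (Fin k) (Fin k) K}
    (hΩa : (Matrix.toBilin' Ω).IsAlt) (hΩn : (Matrix.toBilin' Ω).Nondegenerate) (c : (Fin m → Fin k ⊕ Fin k) → K)
    (hc : ∀ γ : Matrix (Fin k) (Fin k) K, γᵀ * Ω * γ = Ω →
      ∀ w' : Fin m → Fin k ⊕ Fin k, (∑ w, (∏ t, Matrix.fromBlocks γ 0 0 γ (w' t) (w t)) * c w) = c w') :
    c ∈ Submodule.span K {f : (Fin m → Fin k ⊕ Fin k) → K | ∃ (j : ℕ) (e : Fin m ≃ Fin 2 × Fin j) (τ : Fin j → Bool × Bool),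
      f = taggedContraction bp[Ω⁻¹] e τ} := by
  classical
  rw [eq_sum_ext_slice c]
  refine Submodule.sum_mem _ fun κ _ => ?_
  -- the slice is `Sp(Ω)`-invariant, hence a combination of complete contractions of `Ω⁻¹`
  have hslice : (fun u : Fin m → Fin k => c glue[κ, u]) ∈ Submodule.span K {f : (Fin m → Fin k) → K |
      ∃ (j : ℕ) (e : Fin m ≃ Fin 2 × Fin j), f = completeContractionOn Ω⁻¹ e} :=
    mem_span_completeContractionOn_inv_of_sp_invariant hΩa hΩn _ fun γ hγ u => slice_invariant c γ (hc γ hγ) κ u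
  -- push the span through the (linear) extension by zero
  refine Submodule.span_induction (p := fun f _ => ext[κ, f] ∈ Submodule.span K {f : (Fin m → Fin k ⊕ Fin k) → K |
      ∃ (j : ℕ) (e : Fin m ≃ Fin 2 × Fin j) (τ : Fin j → Bool × Bool), f = taggedContraction bp[Ω⁻¹] e τ}) ?_ ?_ ?_ ?_ hslice
  · rintro _ ⟨j, e, rfl⟩
    rw [ext_completeContractionOn]
    exact Submodule.subset_span ⟨j, e, _, rfl⟩
  · rw [ext_zero]; exact Submodule.zero_mem _
  · intro f g _ _ hf hg
    rw [ext_add]; exact Submodule.add_mem _ hf hg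
  · intro r f _ hf
    rw [ext_smul]; exact Submodule.smul_mem _ r hf

end Summit.HodgeConjecture.HodgeConjecture.Theorems.Q8SymplecticPowersDoubledAlphabetFFT

end
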